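import Summits.AtomisticToContinuum.Crystallization.Theorems.SquareWellLayerCakeStackingFaultSparsityOffBoxDefs
import Summits.AtomisticToContinuum.Crystallization.Theorems.ExcessDecayLiouvilleCoarseGrainsPinEval

/-!
# `StackingFaultSparsity` (stmt-AtomisticToContinuum-14296), line `Sketch`: stub `stub_offBoxLayerCert`

The per-layer CERTIFICATION of the off-box scale gap (registered stub of the line skeleton
`Cruxes/StackingFaultSparsity/Lines/Sketch.lean`, vocabulary in `…OffBoxDefs`): for one layer
`layerSum e c k = ∑_{(i,j) ∈ ℤ²} hcpSumTerm e c (k, i, j)` of the certified hcp lattice sums of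
`…CoarseGrainsPinSums`,

* (i) **floor arithmetic**: ONE layer `kk` of the integer evaluator, `hcpSumLoopI p q K e M kk (2K+1)
  = ∑_{ii, jj < 2K+1} ⌊M / N^e⌋` (`hcpSumLoopI_eq`), certifies the finite square sum
  `∑_{[-K,K]²} hcpSumTerm e (p/q) (kk - K, ·, ·)` from both sides, exactly as the 3-D
  `hcpSumFloorSum_le` / `hcpSum_le_hcpSumFloorSum_add` of `…PinEval` with one loop fewer
  (`hcpSumFloorTerm_le`, `hcpSum_le_hcpSumFloorTerm_add_one`, `hcpSumTerm_eq_of_rat`,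
  `hcpSum_sum_Icc_eq_sum_range`);
* (ii) **the in-plane shell tail**: the sup-norm shell `m` of `ℤ²` has `8m` sites, each with
  `hcpSumQ ≥ (3/4)(m - 1/3)²` (`hcpSumQ_ge_of_le_abs_fst/snd`), so with
  `B_m = (3/4)(m - 1/3)² + (k c)²` the shell carries at most `8m · B_m⁻ᵉ`, and the telescoping
  `x^{e-1} - y^{e-1} ≥ (e-1) y^{e-2} (x - y)`, `x - y ≥ (B_m - B_{m-1}) y²`, `B_m - B_{m-1} = (6m-5)/4`
  gives `∑_{m > K} 8m B_m⁻ᵉ ≤ layerTail e K (k c)`; whence summability of every layer family, the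
  truncation bounds `∑_{[-K,K]²} ≤ layerSum ≤ ∑_{[-K,K]²} + layerTail`, and antitonicity in `c`
  (`hcpSumTerm_antitone`).

All statements are `[folklore]` numerics bookkeeping; no definitions.
-/

noncomputable section

namespace Summit.AtomisticToContinuum.Crystallization.Theorems.SquareWellLayerCake.StackingFaultSparsity

open Finset
open Summit.AtomisticToContinuum.Crystallization.Theorems.ExcessDecayLiouvilleCoarseGrains

/-! ## (i) One layer of the integer evaluator: soundness -/

/-- Reindexing a sum over the square `[-K,K]²` by `range (2K+1)²`. [folklore] -/
theorem layerCert_sum_layerSquare_eq_sum_range (K : ℕ) (F : ℤ × ℤ → ℝ) :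
    ∑ ij ∈ layerSquare K, F ij =
      ∑ ii ∈ Finset.range (2 * K + 1), ∑ jj ∈ Finset.range (2 * K + 1), F ((ii : ℤ) - K, (jj : ℤ) - K) := by
  unfold layerSquare
  rw [Finset.sum_product, hcpSum_sum_Icc_eq_sum_range]
  refine Finset.sum_congr rfl fun ii _ => ?_
  rw [hcpSum_sum_Icc_eq_sum_range]

/-- The square sum of layer `kk - K` at `c = p/q` in terms of the integer numerators:
`∑_{[-K,K]²} term = (3q²)ᵉ ∑_{ii, jj < 2K+1} [v ≠ 0] N_v^{-e}`. [folklore] -/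
theorem layerCert_sum_layerSquare_hcpSumTerm_eq (p : ℕ) {q : ℕ} (hq : 0 < q) (e K kk : ℕ) :
    ∑ ij ∈ layerSquare K, hcpSumTerm e ((p : ℝ) / q) ((kk : ℤ) - K, ij.1, ij.2) =
      (3 * (q : ℝ) ^ 2) ^ e * ∑ ii ∈ Finset.range (2 * K + 1), ∑ jj ∈ Finset.range (2 * K + 1),
        (if (((kk : ℤ) - K, (ii : ℤ) - K, (jj : ℤ) - K) : ℤ × ℤ × ℤ) = 0 then 0
          else (((hcpSumNumZ p q ((kk : ℤ) - K) ((ii : ℤ) - K) ((jj : ℤ) - K) : ℝ))⁻¹) ^ e) := by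
  rw [layerCert_sum_layerSquare_eq_sum_range, Finset.mul_sum]
  refine Finset.sum_congr rfl fun ii _ => ?_
  rw [Finset.mul_sum]
  refine Finset.sum_congr rfl fun jj _ => ?_
  exact hcpSumTerm_eq_of_rat p hq e _

/-- **One layer of the floor sum, upper soundness**: `LoopI ≤ M · ∑_{square} [v ≠ 0] N_v^{-e}`. [folklore] -/
theorem layerCert_hcpSumLoopI_le {p q : ℕ} (hp : 0 < p) (hq : 0 < q) (K e M kk : ℕ) :
    (hcpSumLoopI p q K e M kk (2 * K + 1) : ℝ) ≤
      M * ∑ ii ∈ Finset.range (2 * K + 1), ∑ jj ∈ Finset.range (2 * K + 1),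
        (if (((kk : ℤ) - K, (ii : ℤ) - K, (jj : ℤ) - K) : ℤ × ℤ × ℤ) = 0 then 0
          else (((hcpSumNumZ p q ((kk : ℤ) - K) ((ii : ℤ) - K) ((jj : ℤ) - K) : ℝ))⁻¹) ^ e) := by
  rw [hcpSumLoopI_eq, Finset.mul_sum]
  push_cast
  refine Finset.sum_le_sum fun ii _ => ?_
  rw [Finset.mul_sum]
  refine Finset.sum_le_sum fun jj _ => ?_
  exact hcpSumFloorTerm_le hp hq K e M kk ii jj

/-- **One layer of the floor sum, lower soundness**: `M · ∑_{square} [v ≠ 0] N_v^{-e} ≤ LoopI + (2K+1)²`.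
[folklore] -/
theorem layerCert_le_hcpSumLoopI_add {p q : ℕ} (hp : 0 < p) (hq : 0 < q) (K e M kk : ℕ) :
    M * ∑ ii ∈ Finset.range (2 * K + 1), ∑ jj ∈ Finset.range (2 * K + 1),
        (if (((kk : ℤ) - K, (ii : ℤ) - K, (jj : ℤ) - K) : ℤ × ℤ × ℤ) = 0 then 0
          else (((hcpSumNumZ p q ((kk : ℤ) - K) ((ii : ℤ) - K) ((jj : ℤ) - K) : ℝ))⁻¹) ^ e) ≤
      (hcpSumLoopI p q K e M kk (2 * K + 1) : ℝ) + (2 * K + 1) ^ 2 := by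
  have hcount : (2 * (K : ℝ) + 1) ^ 2 =
      ∑ _ii ∈ Finset.range (2 * K + 1), ∑ _jj ∈ Finset.range (2 * K + 1), (1 : ℝ) := by
    simp only [Finset.sum_const, Finset.card_range, nsmul_eq_mul, mul_one]
    push_cast
    ring
  rw [hcpSumLoopI_eq, Finset.mul_sum]
  push_cast
  rw [hcount, ← Finset.sum_add_distrib]
  refine Finset.sum_le_sum fun ii _ => ?_
  rw [Finset.mul_sum, ← Finset.sum_add_distrib]
  refine Finset.sum_le_sum fun jj _ => ?_
  exact hcpSum_le_hcpSumFloorTerm_add_one hp hq K e M kk ii jj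

/-- **Certified lower bound of a square sum**: `(3q²)ᵉ · LoopI / M ≤ ∑_{[-K,K]²} term` (layer `kk - K`,
ratio `p/q`). [folklore] -/
theorem layerCert_layerSquare_ge_cert {p q : ℕ} (hp : 0 < p) (hq : 0 < q) (e K : ℕ) {M : ℕ} (hM : 0 < M)
    (kk : ℕ) :
    (3 * (q : ℝ) ^ 2) ^ e * (hcpSumLoopI p q K e M kk (2 * K + 1) : ℝ) / M ≤
      ∑ ij ∈ layerSquare K, hcpSumTerm e ((p : ℝ) / q) ((kk : ℤ) - K, ij.1, ij.2) := by
  rw [layerCert_sum_layerSquare_hcpSumTerm_eq p hq, mul_div_assoc]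
  refine mul_le_mul_of_nonneg_left ?_ (by positivity)
  rw [div_le_iff₀ (by exact_mod_cast hM)]
  have := layerCert_hcpSumLoopI_le hp hq K e M kk
  linarith

/-- **Certified upper bound of a square sum**: `∑_{[-K,K]²} term ≤ (3q²)ᵉ (LoopI + (2K+1)²) / M`.
[folklore] -/
theorem layerCert_layerSquare_le_cert {p q : ℕ} (hp : 0 < p) (hq : 0 < q) (e K : ℕ) {M : ℕ} (hM : 0 < M)
    (kk : ℕ) :
    ∑ ij ∈ layerSquare K, hcpSumTerm e ((p : ℝ) / q) ((kk : ℤ) - K, ij.1, ij.2) ≤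
      (3 * (q : ℝ) ^ 2) ^ e * ((hcpSumLoopI p q K e M kk (2 * K + 1) : ℝ) + (2 * K + 1) ^ 2) / M := by
  rw [layerCert_sum_layerSquare_hcpSumTerm_eq p hq, mul_div_assoc]
  refine mul_le_mul_of_nonneg_left ?_ (by positivity)
  rw [le_div_iff₀ (by exact_mod_cast hM)]
  have := layerCert_le_hcpSumLoopI_add hp hq K e M kk
  linarith

/-! ## (ii) Squares, in-plane shells and the tail -/

/-- The squares increase. [folklore] -/
theorem layerCert_layerSquare_mono {K K' : ℕ} (h : K ≤ K') : layerSquare K ⊆ layerSquare K' := by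
  intro ij hij
  rw [mem_layerSquare] at hij ⊢
  have : (K : ℤ) ≤ K' := by exact_mod_cast h
  exact ⟨hij.1.trans this, hij.2.trans this⟩

/-- `#[-K,K]² = (2K+1)²`. [folklore] -/
theorem layerCert_card_layerSquare (K : ℕ) : (layerSquare K).card = (2 * K + 1) ^ 2 := by
  simp only [layerSquare, Finset.card_product, Int.card_Icc]
  have : ((K : ℤ) + 1 - -(K : ℤ)).toNat = 2 * K + 1 := by omega
  rw [this]; ring

/-- Outside the square some coordinate is large. [folklore] -/
theorem layerCert_not_mem_layerSquare {K : ℕ} {ij : ℤ × ℤ} :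
    ij ∉ layerSquare K ↔ (K : ℤ) + 1 ≤ |ij.1| ∨ (K : ℤ) + 1 ≤ |ij.2| := by
  rw [mem_layerSquare]; omega

/-- A sup-norm shell `[-m,m]² ∖ [-(m-1), m-1]²` of `ℤ²` has `8m` sites. [folklore] -/
theorem layerCert_card_shell {m : ℕ} (hm : 1 ≤ m) :
    ((layerSquare m \ layerSquare (m - 1)).card : ℝ) = 8 * (m : ℝ) := by
  rw [Finset.card_sdiff_of_subset (layerCert_layerSquare_mono (Nat.sub_le m 1)),
    layerCert_card_layerSquare, layerCert_card_layerSquare]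
  obtain ⟨n, rfl⟩ : ∃ n, m = n + 1 := ⟨m - 1, by omega⟩
  simp only [Nat.add_sub_cancel]
  have h : (2 * n + 1) ^ 2 ≤ (2 * (n + 1) + 1) ^ 2 := Nat.pow_le_pow_left (by omega) 2
  have : (2 * (n + 1) + 1) ^ 2 - (2 * n + 1) ^ 2 = 8 * (n + 1) := by
    zify [h]; ring
  rw [this]; push_cast; ring

/-- **Shell bound for one term of a layer** (any layer `k`, any `c`): if `max(|i|,|j|) ≥ m ≥ 1` then
`hcpSumTerm e c (k,i,j) ≤ ((3/4)(m - 1/3)² + (k c)²)⁻¹ ^ e`. [folklore] -/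
theorem layerCert_hcpSumTerm_le_of_shell (e : ℕ) (c : ℝ) (k : ℤ) {m : ℕ} (hm : 1 ≤ m) {i j : ℤ}
    (hv : (m : ℤ) ≤ |i| ∨ (m : ℤ) ≤ |j|) :
    hcpSumTerm e c (k, i, j) ≤ ((3 / 4 * ((m : ℝ) - 1 / 3) ^ 2 + ((k : ℝ) * c) ^ 2)⁻¹) ^ e := by
  have hQ : 3 / 4 * ((m : ℝ) - 1 / 3) ^ 2 ≤ hcpSumQ (k, i, j) := by
    rcases hv with hi | hj
    · exact hcpSumQ_ge_of_le_abs_fst hm hi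
    · exact hcpSumQ_ge_of_le_abs_snd hm hj
  have hm1 : (1 : ℝ) ≤ m := by exact_mod_cast hm
  have hB : 0 < 3 / 4 * ((m : ℝ) - 1 / 3) ^ 2 + ((k : ℝ) * c) ^ 2 := by
    have : 0 < (m : ℝ) - 1 / 3 := by linarith
    positivity
  have hkc : ((k : ℝ) * c) ^ 2 = (k : ℝ) ^ 2 * c ^ 2 := by ring
  unfold hcpSumTerm
  split_ifs
  · positivity
  · dsimp only
    have hQ0 := hcpSumQ_nonneg (k, i, j)
    refine pow_le_pow_left₀ ?_ (inv_anti₀ hB ?_) e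
    · rw [inv_nonneg]; positivity
    · rw [hkc]; linarith

/-- **Sum over one in-plane shell**: `∑_{shell m} term ≤ 8m · ((3/4)(m - 1/3)² + (k c)²)⁻¹ ^ e`. [folklore] -/
theorem layerCert_sum_shell_le (e : ℕ) (c : ℝ) (k : ℤ) {m : ℕ} (hm : 1 ≤ m) :
    ∑ ij ∈ layerSquare m \ layerSquare (m - 1), hcpSumTerm e c (k, ij.1, ij.2) ≤
      8 * (m : ℝ) * ((3 / 4 * ((m : ℝ) - 1 / 3) ^ 2 + ((k : ℝ) * c) ^ 2)⁻¹) ^ e := by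
  have hbound : ∀ ij ∈ layerSquare m \ layerSquare (m - 1),
      hcpSumTerm e c (k, ij.1, ij.2) ≤ ((3 / 4 * ((m : ℝ) - 1 / 3) ^ 2 + ((k : ℝ) * c) ^ 2)⁻¹) ^ e := by
    intro ij hij
    rw [Finset.mem_sdiff, layerCert_not_mem_layerSquare] at hij
    apply layerCert_hcpSumTerm_le_of_shell e c k hm
    have h1 : ((m - 1 : ℕ) : ℤ) + 1 = m := by omega
    rw [h1] at hij
    exact hij.2
  calc ∑ ij ∈ layerSquare m \ layerSquare (m - 1), hcpSumTerm e c (k, ij.1, ij.2)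
      ≤ ∑ _ij ∈ layerSquare m \ layerSquare (m - 1),
          ((3 / 4 * ((m : ℝ) - 1 / 3) ^ 2 + ((k : ℝ) * c) ^ 2)⁻¹) ^ e := Finset.sum_le_sum hbound
    _ = _ := by rw [Finset.sum_const, nsmul_eq_mul, layerCert_card_shell hm]

/-- `x^{n+1} - y^{n+1} ≥ (n+1) yⁿ (x - y)` for `0 ≤ y ≤ x`. [folklore] -/
theorem layerCert_pow_sub_pow_ge {x y : ℝ} (hy : 0 ≤ y) (hxy : y ≤ x) :
    ∀ n : ℕ, ((n : ℝ) + 1) * y ^ n * (x - y) ≤ x ^ (n + 1) - y ^ (n + 1)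
  | 0 => by simp
  | n + 1 => by
    have ih := layerCert_pow_sub_pow_ge hy hxy n
    have hD : 0 ≤ x ^ (n + 1) - y ^ (n + 1) := sub_nonneg.2 (pow_le_pow_left₀ hy hxy (n + 1))
    have h1 : y * (x ^ (n + 1) - y ^ (n + 1)) ≤ x * (x ^ (n + 1) - y ^ (n + 1)) :=
      mul_le_mul_of_nonneg_right hxy hD
    have h2 : y * (((n : ℝ) + 1) * y ^ n * (x - y)) ≤ y * (x ^ (n + 1) - y ^ (n + 1)) :=
      mul_le_mul_of_nonneg_left ih hy
    have e3 : y ^ (n + 1) = y * y ^ n := pow_succ' y n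
    rw [pow_succ' x (n + 1), pow_succ' y (n + 1)]
    rw [e3] at h1 h2 ⊢
    push_cast
    linarith

/-- **Telescoping step**: for `0 < B₀ ≤ B₁`,
`(n+1) (B₁ - B₀) (B₁⁻¹)^{n+2} ≤ (B₀⁻¹)^{n+1} - (B₁⁻¹)^{n+1}`. [folklore] -/
theorem layerCert_inv_pow_telescope {B₀ B₁ : ℝ} (h₀ : 0 < B₀) (h₀₁ : B₀ ≤ B₁) (n : ℕ) :
    ((n : ℝ) + 1) * (B₁ - B₀) * (B₁⁻¹) ^ (n + 2) ≤ (B₀⁻¹) ^ (n + 1) - (B₁⁻¹) ^ (n + 1) := by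
  have h₁ : 0 < B₁ := h₀.trans_le h₀₁
  have hy0 : 0 < B₁⁻¹ := inv_pos.2 h₁
  have hxy : B₁⁻¹ ≤ B₀⁻¹ := inv_anti₀ h₀ h₀₁
  have hdiff : (B₁ - B₀) * (B₁⁻¹) ^ 2 ≤ B₀⁻¹ - B₁⁻¹ := by
    rw [inv_sub_inv h₀.ne' h₁.ne', div_eq_mul_inv, mul_inv, sq]
    exact mul_le_mul_of_nonneg_left (mul_le_mul_of_nonneg_right hxy hy0.le) (sub_nonneg.2 h₀₁)
  calc ((n : ℝ) + 1) * (B₁ - B₀) * (B₁⁻¹) ^ (n + 2)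
      = ((n : ℝ) + 1) * (B₁⁻¹) ^ n * ((B₁ - B₀) * (B₁⁻¹) ^ 2) := by ring
    _ ≤ ((n : ℝ) + 1) * (B₁⁻¹) ^ n * (B₀⁻¹ - B₁⁻¹) :=
        mul_le_mul_of_nonneg_left hdiff (by positivity)
    _ ≤ (B₀⁻¹) ^ (n + 1) - (B₁⁻¹) ^ (n + 1) := layerCert_pow_sub_pow_ge hy0.le hxy n

/-- **The shell bound in telescopable form**: with `B_m = (3/4)(m - 1/3)² + t²`, for `m ≥ K`,
`8(m+1) · B_{m+1}⁻¹^{n+2} ≤ 32(K+1)/((n+1)(6K+1)) · (B_m⁻¹^{n+1} - B_{m+1}⁻¹^{n+1})`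
(`B_{m+1} - B_m = (6m+1)/4`, `(m+1)/(6m+1) ≤ (K+1)/(6K+1)`). [folklore] -/
theorem layerCert_shell_bound_le (n K m : ℕ) (hm : K ≤ m) (t : ℝ) :
    8 * ((m : ℝ) + 1) * ((3 / 4 * ((m : ℝ) + 1 - 1 / 3) ^ 2 + t ^ 2)⁻¹) ^ (n + 2) ≤
      32 * ((K : ℝ) + 1) / (((n : ℝ) + 1) * (6 * (K : ℝ) + 1)) *
        (((3 / 4 * ((m : ℝ) - 1 / 3) ^ 2 + t ^ 2)⁻¹) ^ (n + 1) -
          ((3 / 4 * ((m : ℝ) + 1 - 1 / 3) ^ 2 + t ^ 2)⁻¹) ^ (n + 1)) := by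
  have hKm : (K : ℝ) ≤ m := by exact_mod_cast hm
  have hsq : (1 : ℝ) / 9 ≤ ((m : ℝ) - 1 / 3) ^ 2 := by
    rcases Nat.eq_zero_or_pos m with h | h
    · rw [h]; norm_num
    · have h1 : (1 : ℝ) ≤ m := by exact_mod_cast h
      nlinarith [h1]
  set B₀ : ℝ := 3 / 4 * ((m : ℝ) - 1 / 3) ^ 2 + t ^ 2 with hB₀
  set B₁ : ℝ := 3 / 4 * ((m : ℝ) + 1 - 1 / 3) ^ 2 + t ^ 2 with hB₁
  have h₀ : 0 < B₀ := by rw [hB₀]; nlinarith [hsq, sq_nonneg t]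
  have hdiff : B₁ - B₀ = (6 * (m : ℝ) + 1) / 4 := by rw [hB₀, hB₁]; ring
  have h₀₁ : B₀ ≤ B₁ := by linarith [hdiff, hKm]
  have h₁ : 0 < B₁ := h₀.trans_le h₀₁
  have hA : 0 < ((n : ℝ) + 1) * (6 * (K : ℝ) + 1) := by positivity
  rw [div_mul_eq_mul_div, le_div_iff₀ hA]
  have htel := layerCert_inv_pow_telescope h₀ h₀₁ n
  have hcoef : ((m : ℝ) + 1) * (6 * (K : ℝ) + 1) ≤ (6 * (m : ℝ) + 1) * ((K : ℝ) + 1) := by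
    nlinarith [hKm]
  have hy : 0 ≤ (B₁⁻¹) ^ (n + 2) := pow_nonneg (inv_nonneg.2 h₁.le) _
  calc 8 * ((m : ℝ) + 1) * (B₁⁻¹) ^ (n + 2) * (((n : ℝ) + 1) * (6 * (K : ℝ) + 1))
      = 8 * ((n : ℝ) + 1) * (B₁⁻¹) ^ (n + 2) * (((m : ℝ) + 1) * (6 * (K : ℝ) + 1)) := by ring
    _ ≤ 8 * ((n : ℝ) + 1) * (B₁⁻¹) ^ (n + 2) * ((6 * (m : ℝ) + 1) * ((K : ℝ) + 1)) :=
        mul_le_mul_of_nonneg_left hcoef (by positivity)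
    _ = 32 * ((K : ℝ) + 1) * (((n : ℝ) + 1) * (B₁ - B₀) * (B₁⁻¹) ^ (n + 2)) := by rw [hdiff]; ring
    _ ≤ 32 * ((K : ℝ) + 1) * ((B₀⁻¹) ^ (n + 1) - (B₁⁻¹) ^ (n + 1)) :=
        mul_le_mul_of_nonneg_left htel (by positivity)

/-- **Square differences are below the telescoping bound**: for `K ≤ K'` (exponent `n + 2`),
`∑_{[-K',K']² ∖ [-K,K]²} term ≤ 32(K+1)/((n+1)(6K+1)) · (B_K⁻¹^{n+1} - B_{K'}⁻¹^{n+1})`. [folklore] -/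
theorem layerCert_sum_sdiff_le_telescope (n : ℕ) (c : ℝ) (k : ℤ) {K K' : ℕ} (h : K ≤ K') :
    ∑ ij ∈ layerSquare K' \ layerSquare K, hcpSumTerm (n + 2) c (k, ij.1, ij.2) ≤
      32 * ((K : ℝ) + 1) / (((n : ℝ) + 1) * (6 * (K : ℝ) + 1)) *
        (((3 / 4 * ((K : ℝ) - 1 / 3) ^ 2 + ((k : ℝ) * c) ^ 2)⁻¹) ^ (n + 1) -
          ((3 / 4 * ((K' : ℝ) - 1 / 3) ^ 2 + ((k : ℝ) * c) ^ 2)⁻¹) ^ (n + 1)) := by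
  induction K', h using Nat.le_induction with
  | base => simp
  | succ K' hKK' ih =>
    have hsplit : layerSquare (K' + 1) \ layerSquare K =
        (layerSquare (K' + 1) \ layerSquare K') ∪ (layerSquare K' \ layerSquare K) :=
      (Finset.sdiff_union_sdiff_cancel (layerCert_layerSquare_mono (Nat.le_succ K'))
        (layerCert_layerSquare_mono hKK')).symm
    have hdisj : Disjoint (layerSquare (K' + 1) \ layerSquare K') (layerSquare K' \ layerSquare K) :=
      Finset.disjoint_left.2 fun v h1 h2 => (Finset.mem_sdiff.1 h1).2 (Finset.mem_sdiff.1 h2).1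
    rw [hsplit, Finset.sum_union hdisj]
    have hshell := layerCert_sum_shell_le (n + 2) c k (m := K' + 1) (by omega)
    rw [show K' + 1 - 1 = K' from rfl] at hshell
    have hsb := layerCert_shell_bound_le n K K' hKK' ((k : ℝ) * c)
    push_cast at hshell ⊢
    linarith [hshell, hsb, ih]

/-- **Square differences are below the in-plane tail**: for `e ≥ 2` and `K ≤ K'`,
`∑_{[-K',K']² ∖ [-K,K]²} hcpSumTerm e c (k, ·, ·) ≤ layerTail e K (k c)`. [folklore] -/
theorem layerCert_sum_sdiff_le_layerTail {e : ℕ} (he : 2 ≤ e) (c : ℝ) (k : ℤ) {K K' : ℕ} (h : K ≤ K') :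
    ∑ ij ∈ layerSquare K' \ layerSquare K, hcpSumTerm e c (k, ij.1, ij.2) ≤ layerTail e K ((k : ℝ) * c) := by
  obtain ⟨n, rfl⟩ : ∃ n, e = n + 2 := ⟨e - 2, by omega⟩
  refine (layerCert_sum_sdiff_le_telescope n c k h).trans ?_
  have hC : 0 ≤ 32 * ((K : ℝ) + 1) / (((n : ℝ) + 1) * (6 * (K : ℝ) + 1)) := by positivity
  have hX : 0 ≤ ((3 / 4 * ((K' : ℝ) - 1 / 3) ^ 2 + ((k : ℝ) * c) ^ 2)⁻¹) ^ (n + 1) := by positivity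
  have hLT : layerTail (n + 2) K ((k : ℝ) * c) = 32 * ((K : ℝ) + 1) / (((n : ℝ) + 1) * (6 * (K : ℝ) + 1)) *
      ((3 / 4 * ((K : ℝ) - 1 / 3) ^ 2 + ((k : ℝ) * c) ^ 2)⁻¹) ^ (n + 1) := by
    unfold layerTail
    rw [show n + 2 - 1 = n + 1 from rfl]
    push_cast
    ring
  rw [hLT]
  nlinarith [mul_nonneg hC hX]

/-- Every finite index set of `ℤ²` lies in some square. [folklore] -/
theorem layerCert_exists_subset_layerSquare (s : Finset (ℤ × ℤ)) (K₀ : ℕ) :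
    ∃ K, K₀ ≤ K ∧ s ⊆ layerSquare K := by
  classical
  refine ⟨max K₀ (s.sup fun ij => (|ij.1| ⊔ |ij.2|).toNat), le_max_left _ _, ?_⟩
  intro ij hij
  have hle : (|ij.1| ⊔ |ij.2|).toNat ≤ s.sup fun ij => (|ij.1| ⊔ |ij.2|).toNat :=
    Finset.le_sup (f := fun ij => (|ij.1| ⊔ |ij.2|).toNat) hij
  rw [mem_layerSquare]
  have h0 : |ij.1| ⊔ |ij.2| ≤ ((|ij.1| ⊔ |ij.2|).toNat : ℤ) := Int.self_le_toNat _
  push_cast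
  omega

/-- **Finite sums of a layer family are bounded by square + tail** (`e ≥ 2`, any `c`, any `K`). [folklore] -/
theorem layerCert_sum_le_square_add_tail {e : ℕ} (he : 2 ≤ e) (c : ℝ) (k : ℤ) (K : ℕ)
    (s : Finset (ℤ × ℤ)) :
    ∑ ij ∈ s, hcpSumTerm e c (k, ij.1, ij.2) ≤
      ∑ ij ∈ layerSquare K, hcpSumTerm e c (k, ij.1, ij.2) + layerTail e K ((k : ℝ) * c) := by
  obtain ⟨K', hKK', hs⟩ := layerCert_exists_subset_layerSquare s K
  calc ∑ ij ∈ s, hcpSumTerm e c (k, ij.1, ij.2)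
      ≤ ∑ ij ∈ layerSquare K', hcpSumTerm e c (k, ij.1, ij.2) :=
        Finset.sum_le_sum_of_subset_of_nonneg hs fun _ _ _ => hcpSumTerm_nonneg e c _
    _ = ∑ ij ∈ layerSquare K' \ layerSquare K, hcpSumTerm e c (k, ij.1, ij.2) +
          ∑ ij ∈ layerSquare K, hcpSumTerm e c (k, ij.1, ij.2) :=
        (Finset.sum_sdiff (layerCert_layerSquare_mono hKK')).symm
    _ ≤ layerTail e K ((k : ℝ) * c) + ∑ ij ∈ layerSquare K, hcpSumTerm e c (k, ij.1, ij.2) := by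
        have := layerCert_sum_sdiff_le_layerTail he c k hKK'
        linarith
    _ = _ := add_comm _ _

/-- **Summability of every layer family** (`e ≥ 2`, any `c`). [folklore] -/
theorem layerCert_summable {e : ℕ} (he : 2 ≤ e) (c : ℝ) (k : ℤ) :
    Summable (fun ij : ℤ × ℤ => hcpSumTerm e c (k, ij.1, ij.2)) :=
  summable_of_sum_le (fun _ => hcpSumTerm_nonneg e c _) (layerCert_sum_le_square_add_tail he c k 0)

/-- **Lower truncation bound**: `∑_{[-K,K]²} term ≤ layerSum e c k`. [folklore] -/
theorem layerCert_square_le_layerSum {e : ℕ} (he : 2 ≤ e) (c : ℝ) (k : ℤ) (K : ℕ) :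
    ∑ ij ∈ layerSquare K, hcpSumTerm e c (k, ij.1, ij.2) ≤ layerSum e c k := by
  unfold layerSum
  exact (layerCert_summable he c k).sum_le_tsum (layerSquare K) fun _ _ => hcpSumTerm_nonneg e c _

/-- **Upper truncation bound**: `layerSum e c k ≤ ∑_{[-K,K]²} term + layerTail e K (k c)`. [folklore] -/
theorem layerCert_layerSum_le_square_add_tail {e : ℕ} (he : 2 ≤ e) (c : ℝ) (k : ℤ) (K : ℕ) :
    layerSum e c k ≤ ∑ ij ∈ layerSquare K, hcpSumTerm e c (k, ij.1, ij.2) + layerTail e K ((k : ℝ) * c) := by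
  unfold layerSum
  exact Real.tsum_le_of_sum_le (fun _ => hcpSumTerm_nonneg e c _) (layerCert_sum_le_square_add_tail he c k K)

/-- **Antitonicity**: the layer sums are antitone in `c > 0`. [folklore] -/
theorem layerCert_layerSum_antitone {e : ℕ} (he : 2 ≤ e) {c c' : ℝ} (hc : 0 < c) (hcc' : c ≤ c') (k : ℤ) :
    layerSum e c' k ≤ layerSum e c k := by
  unfold layerSum
  exact (layerCert_summable he c' k).tsum_le_tsum (fun _ => hcpSumTerm_antitone hc hcc' _)
    (layerCert_summable he c k)

/-! ## The registered stub -/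

/-- **Stub `stub_offBoxLayerCert`** of line `Sketch` of `StackingFaultSparsity` (the per-layer
certification).  (i) ONE layer `kk` of the integer evaluator `hcpSumLoopI` certifies the finite square
sum of the layer `kk - K` at ratio `p/q` from both sides:
`(3q²)ᵉ LoopI / M ≤ ∑_{[-K,K]²} term ≤ (3q²)ᵉ (LoopI + (2K+1)²) / M`; (ii) for `e ≥ 3`, `c > 0` every
layer family is summable, `∑_{[-K,K]²} term ≤ layerSum e c k ≤ ∑_{[-K,K]²} term + layerTail e K (k c)`,
and `layerSum e · k` is antitone. [folklore] -/
theorem stub_offBoxLayerCert :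
    (∀ (e p q K M kk : ℕ), 0 < p → 0 < q → 0 < M →
      (3 * (q : ℝ) ^ 2) ^ e * (hcpSumLoopI p q K e M kk (2 * K + 1) : ℝ) / M ≤
          ∑ ij ∈ layerSquare K, hcpSumTerm e ((p : ℝ) / q) ((kk : ℤ) - K, ij.1, ij.2) ∧
      ∑ ij ∈ layerSquare K, hcpSumTerm e ((p : ℝ) / q) ((kk : ℤ) - K, ij.1, ij.2) ≤
          (3 * (q : ℝ) ^ 2) ^ e * ((hcpSumLoopI p q K e M kk (2 * K + 1) : ℝ) + (2 * K + 1) ^ 2) / M) ∧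
    (∀ (e : ℕ), 3 ≤ e → ∀ (c : ℝ), 0 < c → ∀ (k : ℤ),
      Summable (fun ij : ℤ × ℤ => hcpSumTerm e c (k, ij.1, ij.2)) ∧
      (∀ K : ℕ, 1 ≤ K →
        ∑ ij ∈ layerSquare K, hcpSumTerm e c (k, ij.1, ij.2) ≤ layerSum e c k ∧
        layerSum e c k ≤ ∑ ij ∈ layerSquare K, hcpSumTerm e c (k, ij.1, ij.2) + layerTail e K ((k : ℝ) * c)) ∧
      (∀ c' : ℝ, c ≤ c' → layerSum e c' k ≤ layerSum e c k)) := by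
  refine ⟨fun e p q K M kk hp hq hM =>
    ⟨layerCert_layerSquare_ge_cert hp hq e K hM kk, layerCert_layerSquare_le_cert hp hq e K hM kk⟩, ?_⟩
  intro e he c hc k
  have he2 : 2 ≤ e := le_trans (by norm_num) he
  exact ⟨layerCert_summable he2 c k,
    fun K _ => ⟨layerCert_square_le_layerSum he2 c k K, layerCert_layerSum_le_square_add_tail he2 c k K⟩,
    fun c' hcc' => layerCert_layerSum_antitone he2 hc hcc' k⟩

end Summit.AtomisticToContinuum.Crystallization.Theorems.SquareWellLayerCake.StackingFaultSparsity

end
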